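/- Copyright: the b2b-balaban cell (near-miss cell 7), T⁴-continuum fan-out; row NE7b, leaf lineage `t4-ne7b-formalise-leaf-05`
(gen 52) — E-datum E-ne7bleaf05-g52-1 «(d2′) IS ONE LEVEL ON THE ORBIT» to the OWNER's `Support/HistoryReadinessChainScale`
(p317064 ✓, R-OWNER-59-1); STAGED, NOT FILED under FREEZE (0) unless the row OWNER asks.  Released under the licence of the
surrounding project. -/
import Summits.QuantumFields.BalabanUV.T4Continuum.Support.HistoryReadinessChainScale
import Summits.QuantumFields.BalabanUV.T4Continuum.Support.HistoryRealiseMemory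

/-!
# «(d2′) IS ONE LEVEL ON THE ORBIT»: after a tree-stop the NEXT scale of an `S`-orbit is (i)-small — the printed chain's
predicate `StopAtC` holds one index after the tree's `StopAt`, unconditionally on the process's orbits with memory `≥ 2`
(row NE7b, rider (d2′) of ruling R-OWNER-59-1)

Summits-side support leaf of the T⁴-continuum cell (rung (B)+1 on a FINITE torus only; NOT infinite volume, NOT the mass
gap, NOT the Clay statement; NOT a proof of the spine estimate NE7b — the cell's OWN estimate, NOT PRINTED, NOT PROVED).
[folklore] index-box arithmetic over the Literature typings `B16SProfile` (`Sop`, `Siter`, `ratio`, `DropCtl`, `box`),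
`B16Absorption` ∕ `B16MergeHorizon` (orbit boxes `env` ∕ `envLo`, `cdiv`, `shrink`, `width`, `gains`, the alternation
`altGain_ratio` under the drop control) and `B16StoppingRule` (`CondI`, `StopAt`) BY NAME, and over the row's
`HistoryRealise.orbit` ∕ `Stops` ∕ `PendingAt`, `HistoryRealiseMemory.StopsM` ∕ `stopAt_mono` and the owner's
`HistoryReadinessChainScale.StopAtC` BY NAME; no `[cite:]` tag, no `Prop`-valued fact of Bałaban's minted, zero `sorry`.
B15 = [Balaban1989LargeFieldI] p. 179 and B16 = [Balaban1989LargeFieldII] pp. 384–387 are manuscripts UNDER AUDIT and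
appear only as LOCATORS.

WHY ∕ POSITION (2026-08-22).  The owner's file (g59, p317064 ✓) types the printed chain's `N + 1`-scale predicate
`StopAtC := StopAt ∧ CondI (X (K − N))` and proves the located rider (d2′) «tree ready first, by AT MOST ONE level»
CONDITIONALLY — `stopAtC_succ_of_stopAt` takes `hI : CondI Nsz (X (K + 1))`, (i) at the scale AFTER the tree-stop — on an
ARBITRARY sequence `X`; the refuter's P-ref-g34-1 ∕ leaf-02 g46's E-datum decide, still for arbitrary `X`, the dichotomy
«lag ONE iff (i) at `K_t + 1`; lag `≥ N + 2` under transient loss of (i)»; the owner's g60 part 1 (p318380,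
`HistoryReadinessChainWindows`) re-proves the lifetime budgets ON the chain clock, using `HistoryWindows.condI_from_add_two`
(`L ≥ 3`: from ONE (i)-scale, (i) at every scale `≥ K + 2`) through `condI_from_pair`.  THIS FILE decides the dichotomy ON
THE PROCESS's OWN SEQUENCES `X l = S^l(Z)` = `Siter (ratio L σ) l Z` (= `HistoryRealise.orbit`) under the flow hypotheses
the row carries (`2 ≤ L`, `DropCtl`): for EVERY MEMORY `N ≥ 2` the scale after a tree-stop IS (i)-small — the lag is `≤ 1`
and the transient-loss branch is VOID; at memory `N = 1` transient loss is REAL on a drop-controlled orbit and the lag is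
exactly `N + 2 = 3` (companion `…OrbitToys` §5) — the floor `2 ≤ N` is SHARP.  By-products: persistence laws at `L ≥ 2`,
persistence of tree- AND chain-readiness, and pendency as a one-index test (tree clock; the same holds verbatim for a
chain-clock `PendingAtC` by `stopAtC_Siter_of_le` — a simplification available to the owner's staged part 2).
* §1 PERSISTENCE OF (i) AT `L ≥ 2` (the tree's `HistoryWindows.condI_from_add_two` is the `L ≥ 3`, lag-2 law).  (i) is NOT
  one-step monotone (a no-gain step adds ten layers, contracts nothing: `…OrbitToys` §5 decides an orbit small at `3`, large
  at `4`).  (a) from ONE (i)-scale `s`, (i) at every `m ≥ s + 6` on the horizon (`condI_Siter_late` — the `Y`-half of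
  `B16MergeHorizon.condI_union` WITHOUT its floor `14 ≤ m`); (b) from ONE (i)-scale whose step GAINS, (i) at every later
  scale (`condI_Siter_of_gain`; bookkeeping `env ≤ envLo + 90`, `+ 70` after a gaining step: `env_le_envLo_add_of_gain`);
  (c) from TWO CONSECUTIVE (i)-scales, (i) at every later scale (`condI_Siter_of_two`; one of two consecutive steps gains,
  `altGain_ratio`) — the owner's `condI_from_pair` (p318380) at `L ≥ 2`, self-contained.
* §2 ON `S`-ITERATE SEQUENCES.  A tree-stop at `K` with memory `N ≥ 2` has (i) at `K − 1, K`, so by (c) at EVERY scale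
  `≥ K + 1 − N` on the horizon (`condI_of_stopAt_Siter_ge`), in particular at `K + 1` (`condI_succ_of_stopAt_Siter` —
  the owner's `hI`, DISCHARGED); hence `StopAt … K → Clean (K + 1) → StopAtC … (K + 1)` (`stopAtC_succ_of_stopAt_Siter`;
  with a smaller memory `N′ ≤ N` at the later index, `…_of_le`); tree-stops and chain-stops PERSIST at every later clean
  index (`stopAt_Siter_of_le`, `stopAtC_Siter_of_le`); at `Clean := ⊤` on all horizons the LEAST indices satisfy
  `find StopAtC = find StopAt ∨ = find StopAt + 1` (`find_stopAtC_eq_or`), equality iff (i) at the chain's bottom scale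
  `find StopAt − N` (`find_stopAtC_eq_find_stopAt_iff`; leaf-02 g46's station lemma of that name is the arbitrary-`X` form).
* §3 ON THE ROW's OBJECTS.  `Stops L s R t₀ Z k → CondI 100 (orbit L s t₀ Z (k + 1))` and
  `→ StopAtC 100 (R t₀) ⊤ (orbit L s t₀ Z) (k + 1)` for `2 ≤ R t₀` (`Stops.condI_succ`, `Stops.stopAtC_succ`; `StopsM`
  twins `StopsM.condI_succ`, `StopsM.stopAtC_succ_of_le` for a memory at `k + 1` at most the memory at `k`); READINESS IS
  PERSISTENT (`Stops.of_le`: ready at `k` ⇒ ready at every `k′ ≥ k`), hence PENDENCY IS A ONE-INDEX TEST: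
  `PendingAt L s R t₀ Z K ↔ t₀ ≤ K ∧ ¬ Stops L s R t₀ Z (K − t₀)` (`pendingAt_iff_not_stops_last`).
Decided `S`-orbit toys (one level at memory `13`; THREE at memory `1`): companion `…ChainScaleOrbitToys.lean`.

HONEST SCOPE.  Index arithmetic on hypothesis shapes; nothing of Bałaban's asserted, instantiated or discharged; the
process (`HistoryRealiseMemory.StopsM`, `HistoryGenealogyInstantiateM`) is NOT edited (a `StopAtC` process twin stays the
DESIGN NOTE of R-OWNER-59-1 (3), FREEZE (0)); the side condition `2 ≤ N` (print's `N = R_j` is a positive power of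
`log g_j^{-2}`; the junction residue displays `2 ≤ Rm t 1`) is DISPLAYED and SHARP; census NONE; R∕T rows by count
UNCHANGED; information-grade.  NE7b NOT PRINTED ∕ NOT PROVED; spine 0∕9.  HONEST DEPENDENCY (cell): continuum YM on T⁴ ⇐
BetaPertH ∧ nine spine estimates (0/9 proved); BetaPertH ⇐ (D1) ∧ (D4) ∧ CAP+tail; G-an2-4 gates asym, D1 and NE2/3/4.
-/

open Literature.MathematicalPhysics.QuantumFieldTheory.Balaban1983to89
open Literature.MathematicalPhysics.QuantumFieldTheory.Balaban1983to89.B13ScaleTransfer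
open Literature.MathematicalPhysics.QuantumFieldTheory.Balaban1983to89.B16SProfile
open Literature.MathematicalPhysics.QuantumFieldTheory.Balaban1983to89.B16MergeGeometry
open Literature.MathematicalPhysics.QuantumFieldTheory.Balaban1983to89.B16Absorption
open Literature.MathematicalPhysics.QuantumFieldTheory.Balaban1983to89.B16MergeHorizon
open Literature.MathematicalPhysics.QuantumFieldTheory.Balaban1983to89.B16StoppingRule
open Summit.QuantumFields.BalabanUV.T4Continuum.HistoryRealise
open Summit.QuantumFields.BalabanUV.T4Continuum.HistoryRealiseMemory
open Summit.QuantumFields.BalabanUV.T4Continuum.HistoryReadinessChainScale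

namespace Summit.QuantumFields.BalabanUV.T4Continuum.HistoryReadinessChainScaleOrbit

variable {d : ℕ}

/-! ## §1 Persistence of condition (i) along the `S`-iterates under the drop control -/

/-- **PERSISTENCE OF (i), SIX STEPS ON.**  If `S^s(Y)` satisfies (i) (`100` cubes per side) then so does `S^m(Y)` for
every `m ≥ s + 6` on the drop-controlled horizon `m ≤ m′` (`L ≥ 2`): the orbit box of the `(i)`-box contracts its extent
`99` to `≤ 13` in three gaining steps (at least every other step gains) while the ten layers per step accumulate to a width
`≤ 80`.  The `Y`-half of `B16MergeHorizon.condI_union`, without the absorbed partner and hence WITHOUT the floor `14 ≤ m`.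
(i) is not one-step monotone — a no-gain step adds ten layers and contracts nothing — whence the lag. [folklore] -/
theorem condI_Siter_late {L : ℕ} (hL : 2 ≤ L) {σ : ℕ → ℕ} {m' : ℕ} (hσ : DropCtl σ m')
    {Y : Finset (Pt d)} {s : ℕ} (hY : CondI 100 (Siter (ratio L σ) s Y))
    {m : ℕ} (hsm : s + 6 ≤ m) (hm : m ≤ m') :
    CondI 100 (Siter (ratio L σ) m Y) := by
  have hq : ∀ l, 0 < ratio L σ l := fun l => ratio_pos (by omega) σ l
  obtain ⟨lo, hi, hYb, hhi⟩ := exists_pbox_of_fitsIn hY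
  have hq' : ∀ l, 0 < (fun l => ratio L σ (s + l)) l := fun l => hq (s + l)
  obtain ⟨t, rfl⟩ : ∃ t, m = s + t := ⟨m - s, by omega⟩
  have hYt : Siter (ratio L σ) (s + t) Y ⊆
      pbox (fun i => envLo (fun l => ratio L σ (s + l)) (lo i) t)
        (fun i => env (fun l => ratio L σ (s + l)) (hi i) t) := by
    rw [Siter_add (ratio L σ) s Y t]
    exact (Siter_subset_Siter _ hYb t).trans (Siter_pbox_subset hq' lo hi t)
  have halt : ∀ l, l + 2 ≤ m' - s → 2 ≤ ratio L σ (s + l) ∨ 2 ≤ ratio L σ (s + (l + 1)) :=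
    altGain_shift (altGain_ratio hL hσ) s
  have hg3 : 3 ≤ gains (fun l => ratio L σ (s + l)) t := by
    have := div_two_le_gains_of_altGain (q := fun l => ratio L σ (s + l)) halt t (by omega)
    omega
  have hw : width (fun l => ratio L σ (s + l)) t ≤ 80 :=
    (width_le_eighty (q := fun l => ratio L σ (s + l)) hq' halt t (by omega)).1
  refine fitsIn_of_subset_pbox hYt fun i => ?_
  have h99 : hi i ≤ lo i + 99 := by have := hhi i; push_cast at this; omega
  have h1 := env_sub_envLo_le hq' h99 t
  have h2 : shrink (fun l => ratio L σ (s + l)) 99 t ≤ 13 := shrink_le_thirteen hq' (by norm_num) le_rfl hg3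
  show env (fun l => ratio L σ (s + l)) (hi i) t - envLo (fun l => ratio L σ (s + l)) (lo i) t + 1 ≤ ((100 : ℕ) : ℤ)
  push_cast
  omega

/-! ### Sharper: from a GAINING step on, ONE (i)-small scale persists; hence TWO CONSECUTIVE (i)-small scales
persist (one of any two consecutive steps gains under the drop control) -/

/-- SIDE BOOKKEEPING FROM A GAINING STEP.  Along the shifted ratios `q′ l = q (p + l)` from an (i)-box `[lo, hi]`,
`hi ≤ lo + 99`, at a scale `p` whose step GAINS (`q p ≥ 2`): for every `t ≥ 1` on the horizon the envelopes satisfy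
`env hi t ≤ envLo lo t + 90`, and `≤ envLo lo t + 70` right after a gaining step (`q (p + t − 1) ≥ 2`) — the recursion
`D ↦ ⌈D/q⌉ + 20`: a gaining step maps `99 ↦ ≤ 70` and `90 ↦ ≤ 65`, a non-gaining step follows a gaining one and maps
`70 ↦ 90`. [folklore] -/
theorem env_le_envLo_add_of_gain {L : ℕ} (hL : 2 ≤ L) {σ : ℕ → ℕ} {m' : ℕ} (hσ : DropCtl σ m') {p : ℕ}
    (hg : 2 ≤ ratio L σ p) {lo hi : ℤ} (hw : hi ≤ lo + 99) :
    ∀ t, 1 ≤ t → p + t ≤ m' →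
      env (fun l => ratio L σ (p + l)) hi t ≤ envLo (fun l => ratio L σ (p + l)) lo t + 90 ∧
        (2 ≤ ratio L σ (p + (t - 1)) →
          env (fun l => ratio L σ (p + l)) hi t ≤ envLo (fun l => ratio L σ (p + l)) lo t + 70)
  | 0, h, _ => absurd h (by norm_num)
  | 1, _, _ => by
    have hq0 : 0 < ratio L σ p := ratio_pos (by omega) σ p
    have h1 : hi / (ratio L σ p : ℤ) ≤ lo / (ratio L σ p : ℤ) + cdiv 99 (ratio L σ p) :=
      ediv_le_ediv_add_cdiv hq0 hw
    have h2 : cdiv 99 (ratio L σ p) ≤ 50 :=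
      (cdiv_le_cdiv_two hg (by norm_num)).trans (cdiv_le_of_le_mul (by norm_num) (by norm_num))
    have e1 : env (fun l => ratio L σ (p + l)) hi 1 = hi / (ratio L σ p : ℤ) + 10 := by
      simp [env]
    have e2 : envLo (fun l => ratio L σ (p + l)) lo 1 = lo / (ratio L σ p : ℤ) - 10 := by
      simp [envLo]
    rw [e1, e2]
    exact ⟨by omega, fun _ => by omega⟩
  | t + 2, _, hm => by
    obtain ⟨ih1, ih2⟩ := env_le_envLo_add_of_gain hL hσ hg hw (t + 1) (by omega) (by omega)
    have hq0 : 0 < ratio L σ (p + (t + 1)) := ratio_pos (by omega) σ _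
    have e1 : env (fun l => ratio L σ (p + l)) hi (t + 2) =
        env (fun l => ratio L σ (p + l)) hi (t + 1) / (ratio L σ (p + (t + 1)) : ℤ) + 10 := rfl
    have e2 : envLo (fun l => ratio L σ (p + l)) lo (t + 2) =
        envLo (fun l => ratio L σ (p + l)) lo (t + 1) / (ratio L σ (p + (t + 1)) : ℤ) - 10 := rfl
    have e3 : t + 2 - 1 = t + 1 := rfl
    rw [e1, e2, e3]
    by_cases hgt : 2 ≤ ratio L σ (p + (t + 1))
    · have h1 := ediv_le_ediv_add_cdiv hq0 ih1
      have h2 : cdiv 90 (ratio L σ (p + (t + 1))) ≤ 45 :=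
        (cdiv_le_cdiv_two hgt (by norm_num)).trans (cdiv_le_of_le_mul (by norm_num) (by norm_num))
      exact ⟨by omega, fun _ => by omega⟩
    · have hq1 : (ratio L σ (p + (t + 1)) : ℤ) = 1 := by
        have : ratio L σ (p + (t + 1)) = 1 := by omega
        rw [this]; rfl
      have hprev : 2 ≤ ratio L σ (p + t) := by
        rcases altGain_ratio hL hσ (p + t) (by omega) with h | h
        · exact h
        · exact absurd h hgt
      have h70 := ih2 (by simpa using hprev)
      rw [hq1, Int.ediv_one, Int.ediv_one]
      exact ⟨by omega, fun h => absurd h hgt⟩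

/-- **ONE (i)-SMALL SCALE WHOSE STEP GAINS KEEPS (i) AT EVERY LATER SCALE** on the horizon (side `≤ 91` throughout).
[folklore] -/
theorem condI_Siter_of_gain {L : ℕ} (hL : 2 ≤ L) {σ : ℕ → ℕ} {m' : ℕ} (hσ : DropCtl σ m')
    {Y : Finset (Pt d)} {p : ℕ} (hY : CondI 100 (Siter (ratio L σ) p Y)) (hg : 2 ≤ ratio L σ p)
    {m : ℕ} (hpm : p ≤ m) (hm : m ≤ m') :
    CondI 100 (Siter (ratio L σ) m Y) := by
  rcases Nat.lt_or_ge p m with hlt | hge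
  · have hq : ∀ l, 0 < ratio L σ l := fun l => ratio_pos (by omega) σ l
    obtain ⟨lo, hi, hYb, hhi⟩ := exists_pbox_of_fitsIn hY
    have hq' : ∀ l, 0 < (fun l => ratio L σ (p + l)) l := fun l => hq (p + l)
    obtain ⟨t, rfl⟩ : ∃ t, m = p + t := ⟨m - p, by omega⟩
    have hYt : Siter (ratio L σ) (p + t) Y ⊆
        pbox (fun i => envLo (fun l => ratio L σ (p + l)) (lo i) t)
          (fun i => env (fun l => ratio L σ (p + l)) (hi i) t) := by
      rw [Siter_add (ratio L σ) p Y t]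
      exact (Siter_subset_Siter _ hYb t).trans (Siter_pbox_subset hq' lo hi t)
    refine fitsIn_of_subset_pbox hYt fun i => ?_
    have h99 : hi i ≤ lo i + 99 := by have := hhi i; push_cast at this; omega
    have h := (env_le_envLo_add_of_gain hL hσ hg h99 t (by omega) (by omega)).1
    show env (fun l => ratio L σ (p + l)) (hi i) t - envLo (fun l => ratio L σ (p + l)) (lo i) t + 1 ≤
      ((100 : ℕ) : ℤ)
    push_cast
    omega
  · obtain rfl : m = p := le_antisymm hge hpm
    exact hY

/-- **TWO CONSECUTIVE (i)-SMALL SCALES KEEP (i) AT EVERY LATER SCALE** on the horizon: under the drop control one of the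
steps `s`, `s + 1` gains (`B16MergeHorizon.altGain_ratio`), and the gaining one starts `condI_Siter_of_gain`.  (ONE small
scale does not suffice: §5.) [folklore] -/
theorem condI_Siter_of_two {L : ℕ} (hL : 2 ≤ L) {σ : ℕ → ℕ} {m' : ℕ} (hσ : DropCtl σ m')
    {Y : Finset (Pt d)} {s : ℕ} (h0 : CondI 100 (Siter (ratio L σ) s Y))
    (h1 : CondI 100 (Siter (ratio L σ) (s + 1) Y)) {m : ℕ} (hsm : s ≤ m) (hm : m ≤ m') :
    CondI 100 (Siter (ratio L σ) m Y) := by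
  by_cases hms : m ≤ s + 1
  · rcases Nat.lt_or_ge m (s + 1) with hlt | hge
    · obtain rfl : m = s := by omega
      exact h0
    · obtain rfl : m = s + 1 := le_antisymm hms hge
      exact h1
  · rcases altGain_ratio hL hσ s (by omega) with hg | hg
    · exact condI_Siter_of_gain hL hσ h0 hg hsm hm
    · exact condI_Siter_of_gain hL hσ h1 hg (by omega) hm

/-- a domain inside an index box of radius `r` with `2r + 1 ≤ 100` satisfies (i). [folklore] -/
theorem condI_of_subset_box {X : Finset (Pt d)} {c : Pt d} {r : ℕ} (h : X ⊆ box c r) (hr : 2 * r + 1 ≤ 100) :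
    CondI 100 X := by
  refine fitsIn_of_subset_pbox (lo := fun i => c i - r) (hi := fun i => c i + r) (fun y hy => ?_) (fun i => ?_)
  · exact mem_pbox.2 (mem_box.1 (h hy))
  · show c i + r - (c i - r) + 1 ≤ ((100 : ℕ) : ℤ)
    push_cast
    omega

/-! ## §2 The rider (d2′) on `S`-iterate sequences: the scale after a tree-stop is (i)-small -/

section Siter

variable {L : ℕ} {σ : ℕ → ℕ} {Y : Finset (Pt d)} {N : ℕ} {Clean : ℕ → Prop} {K : ℕ}

/-- **(i) FROM THE WINDOW's BOTTOM ON.**  A tree-stop at `K` with memory `N ≥ 2` — (i) on the `N ≥ 2` scales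
`(K − N, K]`, in particular on the two consecutive scales `K − 1, K` — gives (i) at EVERY scale `m ≥ K + 1 − N` on the
horizon: inside the window by the stop itself, past `K` by `condI_Siter_of_two`. [folklore] -/
theorem condI_of_stopAt_Siter_ge (hL : 2 ≤ L) {m' : ℕ} (hσ : DropCtl σ m')
    (h : StopAt 100 N Clean (fun l => Siter (ratio L σ) l Y) K) (hN : 2 ≤ N)
    {m : ℕ} (hmK : K + 1 - N ≤ m) (hm : m ≤ m') :
    CondI 100 (Siter (ratio L σ) m Y) := by
  obtain ⟨-, hIK, hNK, hall⟩ := h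
  rcases Nat.lt_or_ge K m with hlt | hle
  · have h0 : CondI 100 (Siter (ratio L σ) (K - 1) Y) := (hall (K - 1) (by omega) (by omega)).2
    have h1 : CondI 100 (Siter (ratio L σ) (K - 1 + 1) Y) := by
      rw [show K - 1 + 1 = K by omega]
      exact hIK
    exact condI_Siter_of_two hL hσ h0 h1 (by omega) hm
  · exact (hall m (by omega) hle).2

/-- **THE SCALE AFTER A TREE-STOP IS (i)-SMALL** (memory `N ≥ 2`, `K + 1` on the horizon) — the hypothesis `hI` of the
owner's `stopAtC_succ_of_stopAt`, DISCHARGED on `S`-iterate sequences. [folklore] -/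
theorem condI_succ_of_stopAt_Siter (hL : 2 ≤ L) {m' : ℕ} (hσ : DropCtl σ m')
    (h : StopAt 100 N Clean (fun l => Siter (ratio L σ) l Y) K) (hN : 2 ≤ N) (hm : K + 1 ≤ m') :
    CondI 100 (Siter (ratio L σ) (K + 1) Y) :=
  condI_of_stopAt_Siter_ge hL hσ h hN (by omega) hm

/-- **(d2′) IS ONE LEVEL, UNCONDITIONALLY ON `S`-ITERATES**: a tree-stop at `K` (memory `N ≥ 2`) and cleanliness at
`K + 1` give the printed chain's predicate `StopAtC` at `K + 1`; the memory floor is SHARP (§5: three levels at `N = 1`).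
[folklore] -/
theorem stopAtC_succ_of_stopAt_Siter (hL : 2 ≤ L) {m' : ℕ} (hσ : DropCtl σ m')
    (h : StopAt 100 N Clean (fun l => Siter (ratio L σ) l Y) K) (hN : 2 ≤ N) (hc : Clean (K + 1))
    (hm : K + 1 ≤ m') :
    StopAtC 100 N Clean (fun l => Siter (ratio L σ) l Y) (K + 1) :=
  stopAtC_succ_of_stopAt h hc (condI_succ_of_stopAt_Siter hL hσ h hN hm)

/-- the same with a SMALLER memory `N′ ≤ N` read at the later index (print's memory `R_{j}` read at the current scale
does not grow along the flow; `HistoryRealiseMemory.stopAt_mono`). [folklore] -/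
theorem stopAtC_succ_of_stopAt_Siter_of_le (hL : 2 ≤ L) {m' : ℕ} (hσ : DropCtl σ m')
    (h : StopAt 100 N Clean (fun l => Siter (ratio L σ) l Y) K) (hN : 2 ≤ N) {N' : ℕ} (hN' : N' ≤ N)
    (hc : Clean (K + 1)) (hm : K + 1 ≤ m') :
    StopAtC 100 N' Clean (fun l => Siter (ratio L σ) l Y) (K + 1) :=
  stopAtC_succ_of_stopAt (stopAt_mono hN' h) hc (condI_succ_of_stopAt_Siter hL hσ h hN hm)

/-- **A TREE-STOP PERSISTS**: ready at `K` (memory `N ≥ 2`) ⇒ ready at every later index `K′` on the horizon whose new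
scales `(K, K′]` are clean. [folklore] -/
theorem stopAt_Siter_of_le (hL : 2 ≤ L) {m' : ℕ} (hσ : DropCtl σ m')
    (h : StopAt 100 N Clean (fun l => Siter (ratio L σ) l Y) K) (hN : 2 ≤ N)
    {K' : ℕ} (hKK' : K ≤ K') (hc : ∀ l, K < l → l ≤ K' → Clean l) (hm : K' ≤ m') :
    StopAt 100 N Clean (fun l => Siter (ratio L σ) l Y) K' := by
  have hI : ∀ m, K + 1 - N ≤ m → m ≤ K' → CondI 100 (Siter (ratio L σ) m Y) :=
    fun m h1 h2 => condI_of_stopAt_Siter_ge hL hσ h hN h1 (h2.trans hm)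
  obtain ⟨hpos, -, hNK, hall⟩ := h
  refine ⟨by omega, hI K' (by omega) le_rfl, by omega, fun l h1 h2 => ⟨?_, hI l (by omega) h2⟩⟩
  rcases Nat.lt_or_ge K l with hlt | hle
  · exact hc l hlt h2
  · exact (hall l (by omega) hle).1

/-- **A CHAIN-STOP PERSISTS** likewise (its bottom scale `K′ − N ≥ K − N` is the old bottom, inside the old window, or
late). [folklore] -/
theorem stopAtC_Siter_of_le (hL : 2 ≤ L) {m' : ℕ} (hσ : DropCtl σ m')
    (h : StopAtC 100 N Clean (fun l => Siter (ratio L σ) l Y) K) (hN : 2 ≤ N)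
    {K' : ℕ} (hKK' : K ≤ K') (hc : ∀ l, K < l → l ≤ K' → Clean l) (hm : K' ≤ m') :
    StopAtC 100 N Clean (fun l => Siter (ratio L σ) l Y) K' := by
  refine ⟨stopAt_Siter_of_le hL hσ h.1 hN hKK' hc hm, ?_⟩
  rcases Nat.lt_or_ge (K' - N) (K + 1 - N) with hlt | hge
  · -- then `K' − N = K − N`, the old chain bottom
    have hNK : N ≤ K := le_of_stopAt h.1
    have e : K' - N = K - N := by omega
    rw [e]
    exact h.2
  · exact condI_of_stopAt_Siter_ge hL hσ h.1 hN hge (by omega)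

/-! ### Least indices at `Clean := ⊤` on all horizons: `find StopAt ≤ find StopAtC ≤ find StopAt + 1` -/

/-- a tree-stop somewhere ⇒ a chain-stop one index later. [folklore] -/
theorem exists_stopAtC_of_exists_stopAt (hL : 2 ≤ L) (hσ : ∀ m, DropCtl σ m) (hN : 2 ≤ N)
    (hex : ∃ K, StopAt 100 N (fun _ => True) (fun l => Siter (ratio L σ) l Y) K) :
    ∃ K, StopAtC 100 N (fun _ => True) (fun l => Siter (ratio L σ) l Y) K := by
  obtain ⟨K, hK⟩ := hex
  exact ⟨K + 1, stopAtC_succ_of_stopAt_Siter hL (hσ (K + 1)) hK hN trivial le_rfl⟩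

open Classical in
/-- the tree is ready first: `find StopAt ≤ find StopAtC` (any sequence; `StopAtC → StopAt`). [folklore] -/
theorem find_stopAt_le_find_stopAtC {X : ℕ → Finset (Pt d)}
    (hex : ∃ K, StopAt 100 N Clean X K) (hexC : ∃ K, StopAtC 100 N Clean X K) :
    Nat.find hex ≤ Nat.find hexC :=
  Nat.find_mono fun _ h => StopAtC.stopAt h

open Classical in
/-- … by AT MOST ONE level on `S`-iterates: `find StopAtC ≤ find StopAt + 1`. [folklore] -/
theorem find_stopAtC_le_find_stopAt_succ (hL : 2 ≤ L) (hσ : ∀ m, DropCtl σ m) (hN : 2 ≤ N)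
    (hex : ∃ K, StopAt 100 N (fun _ => True) (fun l => Siter (ratio L σ) l Y) K)
    (hexC : ∃ K, StopAtC 100 N (fun _ => True) (fun l => Siter (ratio L σ) l Y) K) :
    Nat.find hexC ≤ Nat.find hex + 1 :=
  Nat.find_le (stopAtC_succ_of_stopAt_Siter hL (hσ _) (Nat.find_spec hex) hN trivial le_rfl)

open Classical in
/-- **THE DICHOTOMY**: the least chain-stop index is the least tree-stop index or its successor. [folklore] -/
theorem find_stopAtC_eq_or (hL : 2 ≤ L) (hσ : ∀ m, DropCtl σ m) (hN : 2 ≤ N)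
    (hex : ∃ K, StopAt 100 N (fun _ => True) (fun l => Siter (ratio L σ) l Y) K)
    (hexC : ∃ K, StopAtC 100 N (fun _ => True) (fun l => Siter (ratio L σ) l Y) K) :
    Nat.find hexC = Nat.find hex ∨ Nat.find hexC = Nat.find hex + 1 := by
  have h1 := find_stopAt_le_find_stopAtC hex hexC
  have h2 := find_stopAtC_le_find_stopAt_succ hL hσ hN hex hexC
  omega

open Classical in
/-- … and WHICH: the two least indices coincide iff (i) holds at the chain's bottom scale `find StopAt − N` (at a pure
join of far constituents it does not: §4). [folklore] -/
theorem find_stopAtC_eq_find_stopAt_iff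
    (hex : ∃ K, StopAt 100 N Clean (fun l => Siter (ratio L σ) l Y) K)
    (hexC : ∃ K, StopAtC 100 N Clean (fun l => Siter (ratio L σ) l Y) K) :
    Nat.find hexC = Nat.find hex ↔ CondI 100 (Siter (ratio L σ) (Nat.find hex - N) Y) := by
  constructor
  · intro h
    have hs := (Nat.find_spec hexC).2
    rw [h] at hs
    exact hs
  · intro hI
    exact le_antisymm (Nat.find_le ((stopAtC_iff_of_condI hI).2 (Nat.find_spec hex)))
      (find_stopAt_le_find_stopAtC hex hexC)

end Siter

/-! ## §3 On the row's objects: `orbit`, `Stops`, `StopsM`, `PendingAt` -/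

section Orbit

variable {L : ℕ} {s R : ℕ → ℕ} {Rm : ℕ → ℕ → ℕ} {t₀ : ℕ} {Z : Finset (Pt d)} {k : ℕ}

/-- the orbit IS an `S`-iterate sequence along the flow read from `t₀` (definitional). [folklore] -/
theorem orbit_eq_Siter (L : ℕ) (s : ℕ → ℕ) (t₀ : ℕ) (Z : Finset (Pt d)) :
    orbit L s t₀ Z = fun l => Siter (ratio L (fun i => s (t₀ + i))) l Z := rfl
/-- **THE SCALE AFTER READINESS IS (i)-SMALL** on the process's orbit (memory `R t₀ ≥ 2`). [folklore] -/
theorem Stops.condI_succ (hL : 2 ≤ L) (hdrop : ∀ m, DropCtl s m) (h : Stops L s R t₀ Z k) (hN : 2 ≤ R t₀) :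
    CondI 100 (orbit L s t₀ Z (k + 1)) :=
  condI_succ_of_stopAt_Siter (Y := Z) hL (dropCtl_from hdrop t₀ (k + 1)) h hN le_rfl

/-- … indeed EVERY scale from the readiness window's bottom `k + 1 − R t₀` on. [folklore] -/
theorem Stops.condI_of_ge (hL : 2 ≤ L) (hdrop : ∀ m, DropCtl s m) (h : Stops L s R t₀ Z k) (hN : 2 ≤ R t₀)
    {m : ℕ} (hm : k + 1 - R t₀ ≤ m) : CondI 100 (orbit L s t₀ Z m) :=
  condI_of_stopAt_Siter_ge (Y := Z) hL (dropCtl_from hdrop t₀ m) h hN hm le_rfl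

/-- **(d2′) ON THE ORBIT**: ready at `k` (tree) ⇒ the printed chain's predicate at `k + 1`. [folklore] -/
theorem Stops.stopAtC_succ (hL : 2 ≤ L) (hdrop : ∀ m, DropCtl s m) (h : Stops L s R t₀ Z k) (hN : 2 ≤ R t₀) :
    StopAtC 100 (R t₀) (fun _ => True) (orbit L s t₀ Z) (k + 1) :=
  stopAtC_succ_of_stopAt_Siter (Y := Z) hL (dropCtl_from hdrop t₀ (k + 1)) h hN trivial le_rfl

/-- **READINESS IS PERSISTENT**: ready at `k` ⇒ ready at every `k′ ≥ k` (memory `R t₀ ≥ 2`). [folklore] -/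
theorem Stops.of_le (hL : 2 ≤ L) (hdrop : ∀ m, DropCtl s m) (h : Stops L s R t₀ Z k) (hN : 2 ≤ R t₀)
    {k' : ℕ} (hkk' : k ≤ k') : Stops L s R t₀ Z k' :=
  stopAt_Siter_of_le (Y := Z) hL (dropCtl_from hdrop t₀ k') h hN hkk' (fun _ _ _ => trivial) le_rfl

/-- **PENDENCY IS A ONE-INDEX TEST**: under persistence, «no stop up to the cutoff» ⟺ «no stop AT the cutoff's relative
index». [folklore] -/
theorem pendingAt_iff_not_stops_last (hL : 2 ≤ L) (hdrop : ∀ m, DropCtl s m) (hN : 2 ≤ R t₀) {K : ℕ} :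
    PendingAt L s R t₀ Z K ↔ t₀ ≤ K ∧ ¬ Stops L s R t₀ Z (K - t₀) := by
  constructor
  · rintro ⟨hK, hno⟩
    exact ⟨hK, hno (K - t₀) le_rfl⟩
  · rintro ⟨hK, hno⟩
    exact ⟨hK, fun k hk hs => hno (Stops.of_le hL hdrop hs hN hk)⟩

/-- `StopsM` twin: an `Rm`-stop at `k` (memory `Rm t₀ k ≥ 2` — the junction residue's `2 ≤ Rm t 1` kind of floor)
makes the next scale (i)-small … [folklore] -/
theorem StopsM.condI_succ (hL : 2 ≤ L) (hdrop : ∀ m, DropCtl s m) (h : StopsM L s Rm t₀ Z k)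
    (hN : 2 ≤ Rm t₀ k) : CondI 100 (orbit L s t₀ Z (k + 1)) :=
  condI_succ_of_stopAt_Siter (Y := Z) hL (dropCtl_from hdrop t₀ (k + 1)) h hN le_rfl

/-- … and gives the chain predicate at `k + 1` for any memory there NOT EXCEEDING the memory at `k` (print's current
memory `R (t₀ + k)` along a non-increasing size function). [folklore] -/
theorem StopsM.stopAtC_succ_of_le (hL : 2 ≤ L) (hdrop : ∀ m, DropCtl s m) (h : StopsM L s Rm t₀ Z k)
    (hN : 2 ≤ Rm t₀ k) (hmono : Rm t₀ (k + 1) ≤ Rm t₀ k) :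
    StopAtC 100 (Rm t₀ (k + 1)) (fun _ => True) (orbit L s t₀ Z) (k + 1) :=
  stopAtC_succ_of_stopAt_Siter_of_le (Y := Z) hL (dropCtl_from hdrop t₀ (k + 1)) h hN hmono trivial le_rfl

end Orbit
end Summit.QuantumFields.BalabanUV.T4Continuum.HistoryReadinessChainScaleOrbit
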